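import Literature.Computability.AlgebraicComplexity.FirstTypeHoleBound
import Literature.Computability.AlgebraicComplexity.MultinomialEntropy
import HarnessLib

/-!
# Counting multi-class type classes: products of multinomial coefficients and entropy bounds
(Vassilevska Williams–Xu–Xu–Zhou 2024, §6.2: "`numxblock = 2^{∑_t H(γ̃_{X,t}) · A_{t,1} n_t ± o(n)}`",
"`numalpha = 2^{∑_t H(α_t) · A_{t,1} n_t ± o(n)}`"; Lemma 3.3) — proved

Topic `Literature/Computability/AlgebraicComplexity`.  The counts of §6.2 of Vassilevska
Williams–Xu–Xu–Zhou, *New bounds for matrix multiplication: from alpha to omega* (SODA 2024,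
arXiv:2307.07970) — remaining level-`(ℓ−1)` blocks `numxblock`, consistent triples `numalpha`, the
`K̂'` with given level-`ℓ` complete split distributions — are all sizes of MULTI-CLASS TYPE CLASSES
(`FirstTypeHoleBound.multiTypeClass`: words with prescribed letter counts on every class of positions,
here the chunk sets of the terms), and the paper evaluates them by Lemma 3.3 (method of types):
`2^{∑_t n_t H(k_t/n_t) ± o(n)}`.  This file PROVES the exact and the two-sided entropy forms:

* `fibreEquiv`, `multiTypeClassEquiv`, `card_multiTypeClass_eq_prod` — a multi-class type class is
  the product of the type classes of its classes, `|MTC(cls, k)| = ∏_g |T(class g, k g)|`;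
* `card_multiTypeClass_eq_prod_multinomial` — `= ∏_g binom(|class g|; k g)` (for counts summing to the
  class sizes);
* `card_multiTypeClass_le_two_rpow`, `two_rpow_le_mul_card_multiTypeClass` — **Lemma 3.3**:
  `2^{∑_g |class g| H(k g/|class g|)} / ∏_g (|class g|+1)^{|A|} ≤ |MTC| ≤ 2^{∑_g |class g| H(k g/|class g|)}`.

Everything is proved; two definitions (the equivalences); no named facts.

## References

* V. Vassilevska Williams, Y. Xu, Z. Xu, R. Zhou, *New bounds for matrix multiplication: from alpha
  to omega*, SODA 2024, arXiv:2307.07970 (held: `paper:arxiv-2307.07970`), §6.2 (numxblock,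
  numyblock, numzblock, numalpha) and Lemma 3.3. [VassilevskaWilliamsXuXuZhou2024]
* J. Alman, R. Duan, V. Vassilevska Williams, Y. Xu, Z. Xu, R. Zhou, *More asymmetry yields faster
  matrix multiplication*, SODA 2025, Lemma 3.3 (the entropy estimate used). [AlmanDuanVassilevskaWilliamsXuXuZhou2025]
-/

noncomputable section

open scoped BigOperators
open Finset

namespace Literature.Computability.AlgebraicComplexity

section Count

variable {A X Γ : Type*}

/-- **`(X → A) ≃ ∏_g (class g → A)`**: a word is the family of its restrictions to the classes. [folklore] -/
def fibreEquiv (cls : X → Γ) : (X → A) ≃ ((g : Γ) → {x // cls x = g} → A) where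
  toFun f g x := f x.1
  invFun h x := h (cls x) ⟨x, rfl⟩
  left_inv f := rfl
  right_inv h := by
    funext g x
    rcases x with ⟨x, rfl⟩
    rfl

/-- Entries of the fibrewise decomposition. [folklore] -/
@[simp] theorem fibreEquiv_apply (cls : X → Γ) (f : X → A) (g : Γ) (x : {x // cls x = g}) : fibreEquiv cls f g x = f x.1 := rfl

variable [Fintype A] [DecidableEq A] [Fintype X] [DecidableEq X] [Fintype Γ] [DecidableEq Γ]

/-- Membership in a multi-class type class is membership of every restriction in its type class. [folklore] -/
theorem mem_multiTypeClass_iff_forall_restrict (cls : X → Γ) (k : Γ → A → ℕ) (w : X → A) :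
    w ∈ multiTypeClass cls k ↔ ∀ g, fibreEquiv cls w g ∈ typeClassOn {x // cls x = g} (k g) := by
  rw [mem_multiTypeClass]
  refine forall_congr' fun g => ?_
  rw [mem_typeClassOn]
  refine forall_congr' fun a => ?_
  rw [countOn_classOf_eq]
  rfl

/-- **A multi-class type class is the product of the type classes of its classes.** [folklore] -/
def multiTypeClassEquiv (cls : X → Γ) (k : Γ → A → ℕ) :
    ↥(multiTypeClass cls k) ≃ ((g : Γ) → ↥(typeClassOn {x // cls x = g} (k g))) :=
  ((fibreEquiv cls).subtypeEquiv (mem_multiTypeClass_iff_forall_restrict cls k)).trans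
    (Equiv.subtypePiEquivPi (p := fun g v => v ∈ typeClassOn {x // cls x = g} (k g)))

/-- **`|MTC(cls, k)| = ∏_g |T(class g, k g)|`.** [cite: VassilevskaWilliamsXuXuZhou2024, §6.2 and Claim 5.14 (proof: "count … for each of these subsets of indices, and multiply them together")] -/
theorem card_multiTypeClass_eq_prod (cls : X → Γ) (k : Γ → A → ℕ) :
    (multiTypeClass cls k).card = ∏ g, (typeClassOn {x // cls x = g} (k g)).card := by
  rw [← Fintype.card_coe, Fintype.card_congr (multiTypeClassEquiv cls k), Fintype.card_pi]
  exact prod_congr rfl fun g _ => Fintype.card_coe _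

/-- **`|MTC(cls, k)| = ∏_g binom(|class g|; k g)`** for counts summing to the class sizes. [cite: VassilevskaWilliamsXuXuZhou2024, §6.2 (numxblock, numalpha) and Lemma 3.3] -/
theorem card_multiTypeClass_eq_prod_multinomial (cls : X → Γ) (k : Γ → A → ℕ) (hk : ∀ g, ∑ a, k g a = Fintype.card {x // cls x = g}) :
    (multiTypeClass cls k).card = ∏ g, Nat.multinomial univ (k g) := by
  rw [card_multiTypeClass_eq_prod]
  exact prod_congr rfl fun g _ => card_typeClassOn_eq_multinomial (k g) (hk g)

/-- **Lemma 3.3, upper half**: `|MTC| ≤ 2^{∑_g |class g| · H(k g / |class g|)}`. [cite: VassilevskaWilliamsXuXuZhou2024, Lemma 3.3 and §6.2] -/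
theorem card_multiTypeClass_le_two_rpow (cls : X → Γ) (k : Γ → A → ℕ) (hk : ∀ g, ∑ a, k g a = Fintype.card {x // cls x = g}) :
    ((multiTypeClass cls k).card : ℝ) ≤
      2 ^ (∑ g, (Fintype.card {x // cls x = g} : ℝ) * shannonEntropy fun a => (k g a : ℝ) / Fintype.card {x // cls x = g}) := by
  rw [card_multiTypeClass_eq_prod_multinomial cls k hk, Real.rpow_sum_of_pos two_pos]
  push_cast
  refine prod_le_prod (fun g _ => by positivity) fun g _ => ?_
  exact multinomial_le_two_rpow_mul_shannonEntropy (k g) (hk g)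

/-- **Lemma 3.3, lower half**: `2^{∑_g |class g| · H(k g / |class g|)} ≤ (∏_g (|class g|+1)^{|A|}) · |MTC|`. [cite: VassilevskaWilliamsXuXuZhou2024, Lemma 3.3 and §6.2] -/
theorem two_rpow_le_mul_card_multiTypeClass (cls : X → Γ) (k : Γ → A → ℕ) (hk : ∀ g, ∑ a, k g a = Fintype.card {x // cls x = g}) :
    (2 : ℝ) ^ (∑ g, (Fintype.card {x // cls x = g} : ℝ) * shannonEntropy fun a => (k g a : ℝ) / Fintype.card {x // cls x = g}) ≤
      (∏ g, ((Fintype.card {x // cls x = g} : ℝ) + 1) ^ Fintype.card A) * (multiTypeClass cls k).card := by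
  rw [card_multiTypeClass_eq_prod_multinomial cls k hk, Real.rpow_sum_of_pos two_pos]
  push_cast
  rw [← prod_mul_distrib]
  refine prod_le_prod (fun g _ => by positivity) fun g _ => ?_
  exact two_rpow_mul_shannonEntropy_le_mul_multinomial (k g) (hk g)

/-- The counts of an inhabited multi-class type class sum to the class sizes (so the three theorems
above apply to the class of any word). [folklore] -/
theorem sum_eq_card_of_nonempty {cls : X → Γ} {k : Γ → A → ℕ} (h : (multiTypeClass cls k).Nonempty) (g : Γ) :
    ∑ a, k g a = Fintype.card {x // cls x = g} := by
  obtain ⟨w, hw⟩ := h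
  exact sum_eq_card_of_mem_multiTypeClass hw g

end Count

end Literature.Computability.AlgebraicComplexity
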